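import Summits.CriticalPhenomena.PercolationContinuityZ3.Theorems.FK.PositiveFieldContinuity
import Summits.CriticalPhenomena.PercolationContinuityZ3.Theorems.FK.PressureBetaDerivativeField
import HarnessLib

/-!
# THE PLUS STATE IS JOINTLY CONTINUOUS IN `(β,h)` ON THE OPEN QUADRANT `β > 0`, `h > 0`; SO ARE `m(β,h)`, THE ENERGY AND
# THE GRADIENT OF THE PRESSURE (Friedli–Velenik 2017, Lemma 3.31, Exercise 3.17, Thm. 3.25 (1); GKS monotonicity)

Claimed R42 (8)(c) in the cell INBOX at 2026-08-29T01:45:00Z by fkp-10a gen 357 (NEW CLAIM #3 of the gen), addressed to coordinator fk-4 gen 288 (seated 01:00Z 2026-08-29 by l.8634; R160 / R161 in force); lineage row FO-10a-g357z (self-suggested), package g357-limit, label ZF-C.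
Helper file of the `fk-continuity` build cell (bschramm lane; `--supports stmt-CriticalPhenomena-4575`); builds on
p205010 (kernel theorem, internal audit signed; external expert review pending). No definitions, no named facts, no
sorries; standard axioms. UNCONDITIONAL (nearest-neighbour Ising model on `ℤ^d`, `d ≥ 1`).

`(β,h) ↦ ⟨σ_A⟩⁺_{β,h}` is nondecreasing in each variable on `[0,∞)²` (GKS, `plusCorr_mono_params`) and, on the open
quadrant, continuous in each variable separately (`continuousAt_plusCorr_beta_of_pos_field`, `PressureBetaDerivativeField`;
`continuousAt_plusCorr_field_of_pos`, `PositiveFieldContinuity`). A real function of two real variables that is monotone in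
each variable and separately continuous is jointly continuous (elementary squeeze between the values at two opposite
corners of a small box):

* `continuousAt_uncurry_of_monotone_of_continuousAt` — the elementary lemma (pure topology/order on `ℝ × ℝ`);
* **`continuousAt_plusCorr_uncurry`** — for `d ≥ 1`, `β > 0`, `h > 0` and every finite `A`,
  `ContinuousAt (fun p : ℝ × ℝ => ⟨σ_A⟩⁺_{p.1,p.2}) (β,h)`: the plus (= unique) state depends continuously on `(β,h)` jointly
  on the open quadrant (weak continuity on local observables);
* `continuousAt_magnetizationInField_uncurry` — `(β,h) ↦ m(β,h)` jointly continuous there;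
  `continuousAt_energyField_uncurry` — so is the `β`-derivative of the pressure `Σᵢ ⟨σ_0σ_{eᵢ}⟩⁺_{β,h} + h m(β,h)`, and
  `continuousAt_deriv_pressure_field_uncurry` — so is the `h`-derivative `β m(β,h)`: both partial derivatives of `ψ` are
  jointly continuous on `{β > 0, h > 0}` (the ingredients of `ψ ∈ C¹` there).

## References

* S. Friedli, Y. Velenik, *Statistical Mechanics of Lattice Systems*, CUP (2017), Lemma 3.31, Exercise 3.17, Thm. 3.25 (1),
  Thm. 3.43. [FriedliVelenik2017]
-/

noncomputable section

namespace Summit.CriticalPhenomena.PercolationContinuityZ3.Theorems.FK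

namespace IsingSusceptibility

open MeasureTheory Filter Topology Finset Set
open Literature.Probability.LatticeModels
open Summit.CriticalPhenomena.PercolationContinuityZ3.Theorems.FK.IsingEnergyDensity

variable {d : ℕ}

/-! ### Monotone in each variable and separately continuous ⇒ jointly continuous -/

/-- **A function of two real variables which is nondecreasing in each variable on a neighbourhood `(x−r, x+r) × (y−r, y+r)`
and continuous in each variable separately there is jointly continuous at `(x,y)`** (squeeze between the two opposite
corners of a small box). [folklore] -/
theorem continuousAt_uncurry_of_monotone_of_continuousAt {f : ℝ → ℝ → ℝ} {x y r : ℝ} (hr : 0 < r)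
    (hmono : ∀ a a' b b', a ∈ Ioo (x - r) (x + r) → a' ∈ Ioo (x - r) (x + r) → b ∈ Ioo (y - r) (y + r) →
      b' ∈ Ioo (y - r) (y + r) → a ≤ a' → b ≤ b' → f a b ≤ f a' b')
    (hx : ContinuousAt (fun a => f a y) x) (hy : ∀ a ∈ Ioo (x - r) (x + r), ContinuousAt (fun b => f a b) y) :
    ContinuousAt (fun p : ℝ × ℝ => f p.1 p.2) (x, y) := by
  rw [Metric.continuousAt_iff]
  intro ε hε
  -- continuity in the first variable at `(·, y)`
  obtain ⟨δ₁, hδ₁, h₁⟩ := Metric.continuousAt_iff.1 hx (ε / 2) (by linarith)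
  set s := min (δ₁ / 2) (r / 2) with hs
  have hs0 : 0 < s := lt_min (by linarith) (by linarith)
  have hsδ : s < δ₁ := lt_of_le_of_lt (min_le_left _ _) (by linarith)
  have hsr : s < r := lt_of_le_of_lt (min_le_right _ _) (by linarith)
  have hxp : x + s ∈ Ioo (x - r) (x + r) := ⟨by linarith, by linarith⟩
  have hxm : x - s ∈ Ioo (x - r) (x + r) := ⟨by linarith, by linarith⟩
  have hfp : |f (x + s) y - f x y| < ε / 2 := by
    have := h₁ (x := x + s) (by rw [Real.dist_eq]; simpa [abs_of_pos hs0] using hsδ)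
    rwa [Real.dist_eq] at this
  have hfm : |f (x - s) y - f x y| < ε / 2 := by
    have := h₁ (x := x - s) (by rw [Real.dist_eq]; simpa [abs_of_pos hs0] using hsδ)
    rwa [Real.dist_eq] at this
  -- continuity in the second variable at the two corners
  obtain ⟨δ₂, hδ₂, h₂⟩ := Metric.continuousAt_iff.1 (hy (x + s) hxp) (ε / 2) (by linarith)
  obtain ⟨δ₃, hδ₃, h₃⟩ := Metric.continuousAt_iff.1 (hy (x - s) hxm) (ε / 2) (by linarith)
  set t := min (min (δ₂ / 2) (δ₃ / 2)) (r / 2) with ht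
  have ht0 : 0 < t := lt_min (lt_min (by linarith) (by linarith)) (by linarith)
  have htδ₂ : t < δ₂ := lt_of_le_of_lt ((min_le_left _ _).trans (min_le_left _ _)) (by linarith)
  have htδ₃ : t < δ₃ := lt_of_le_of_lt ((min_le_left _ _).trans (min_le_right _ _)) (by linarith)
  have htr : t < r := lt_of_le_of_lt (min_le_right _ _) (by linarith)
  have hyp : y + t ∈ Ioo (y - r) (y + r) := ⟨by linarith, by linarith⟩
  have hym : y - t ∈ Ioo (y - r) (y + r) := ⟨by linarith, by linarith⟩
  have hgp : |f (x + s) (y + t) - f (x + s) y| < ε / 2 := by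
    have := h₂ (x := y + t) (by rw [Real.dist_eq]; simpa [abs_of_pos ht0] using htδ₂)
    rwa [Real.dist_eq] at this
  have hgm : |f (x - s) (y - t) - f (x - s) y| < ε / 2 := by
    have := h₃ (x := y - t) (by rw [Real.dist_eq]; simpa [abs_of_pos ht0] using htδ₃)
    rwa [Real.dist_eq] at this
  -- the box of half-widths `s`, `t` works
  refine ⟨min s t, lt_min hs0 ht0, fun p hp => ?_⟩
  have hp1 : |p.1 - x| < s := by
    have := (max_lt_iff.1 ((Prod.dist_eq (x := p) (y := (x, y))) ▸ hp)).1
    rw [Real.dist_eq] at this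
    exact lt_of_lt_of_le this (min_le_left _ _)
  have hp2 : |p.2 - y| < t := by
    have := (max_lt_iff.1 ((Prod.dist_eq (x := p) (y := (x, y))) ▸ hp)).2
    rw [Real.dist_eq] at this
    exact lt_of_lt_of_le this (min_le_right _ _)
  rw [abs_lt] at hp1 hp2 hfp hfm hgp hgm
  have ha : p.1 ∈ Ioo (x - r) (x + r) := ⟨by linarith, by linarith⟩
  have hb : p.2 ∈ Ioo (y - r) (y + r) := ⟨by linarith, by linarith⟩
  have hup : f p.1 p.2 ≤ f (x + s) (y + t) := hmono _ _ _ _ ha hxp hb hyp (by linarith) (by linarith)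
  have hlo : f (x - s) (y - t) ≤ f p.1 p.2 := hmono _ _ _ _ hxm ha hym hb (by linarith) (by linarith)
  rw [Real.dist_eq, abs_lt]
  constructor <;> linarith

/-! ### The plus state, the magnetisation and the partial derivatives of the pressure are jointly continuous -/

/-- **THE PLUS STATE IS JOINTLY CONTINUOUS IN `(β,h)` ON THE OPEN QUADRANT**: for `d ≥ 1`, `β > 0`, `h > 0` and every
finite `A`, `(b,t) ↦ ⟨σ_A⟩⁺_{b,t}` is continuous at `(β,h)` (nondecreasing in each variable by GKS; continuous in `b` at
`t > 0` and in `t` at `t > 0` separately). [cite: FriedliVelenik2017, Lemma 3.31, Exercise 3.17 and Thm. 3.25 (1)] -/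
theorem continuousAt_plusCorr_uncurry (hd : 1 ≤ d) {β h : ℝ} (hβ : 0 < β) (hh : 0 < h) (A : Finset (Site d)) :
    ContinuousAt (fun p : ℝ × ℝ => plusCorr d p.1 p.2 A) (β, h) := by
  set r := min β h with hr
  have hr0 : 0 < r := lt_min hβ hh
  have hrβ : r ≤ β := min_le_left _ _
  have hrh : r ≤ h := min_le_right _ _
  refine continuousAt_uncurry_of_monotone_of_continuousAt (f := fun b t => plusCorr d b t A) hr0 ?_ ?_ ?_
  · intro a a' b b' ha _ hb _ haa' hbb'
    exact plusCorr_mono_params (by linarith [ha.1]) haa' (by linarith [hb.1]) hbb' A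
  · exact continuousAt_plusCorr_beta_of_pos_field hd hβ hh A
  · intro a ha
    exact continuousAt_plusCorr_field_of_pos hd (by linarith [ha.1]) hh A

/-- **`(β,h) ↦ m(β,h)` is jointly continuous on `{β > 0, h > 0}`** (`d ≥ 1`). [cite: FriedliVelenik2017, Lemma 3.31 and Thm. 3.25 (1)] -/
theorem continuousAt_magnetizationInField_uncurry (hd : 1 ≤ d) {β h : ℝ} (hβ : 0 < β) (hh : 0 < h) :
    ContinuousAt (fun p : ℝ × ℝ => magnetizationInField d p.1 p.2) (β, h) := by
  simp only [magnetizationInField_eq_plusCorr]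
  exact continuousAt_plusCorr_uncurry hd hβ hh {0}

/-- **The `β`-derivative of the pressure `E(β,h) = Σᵢ ⟨σ_0σ_{eᵢ}⟩⁺_{β,h} + h m(β,h)` is jointly continuous on `{β > 0, h > 0}`**
(`d ≥ 1`; it IS `∂ψ/∂β` there, `hasDerivAt_pressure_beta_of_pos_field`). [cite: FriedliVelenik2017, Lemma 3.31, Thm. 3.25 (1) and Thm. 3.6] -/
theorem continuousAt_energyField_uncurry (hd : 1 ≤ d) {β h : ℝ} (hβ : 0 < β) (hh : 0 < h) :
    ContinuousAt (fun p : ℝ × ℝ => ∑ i, plusCorr d p.1 p.2 {0, Pi.single i 1} + p.2 * magnetizationInField d p.1 p.2)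
      (β, h) :=
  (tendsto_finsetSum _ fun i _ => (continuousAt_plusCorr_uncurry hd hβ hh {0, Pi.single i 1}).tendsto).add
    ((continuous_snd.tendsto (β, h)).mul (continuousAt_magnetizationInField_uncurry hd hβ hh).tendsto)

/-- **The `h`-derivative of the pressure `β m(β,h)` is jointly continuous on `{β > 0, h > 0}`** (`d ≥ 1`; it IS `∂ψ/∂h` there,
`hasDerivAt_pressure_field`). [cite: FriedliVelenik2017, Thm. 3.43 and Lemma 3.31] -/
theorem continuousAt_deriv_pressure_field_uncurry (hd : 1 ≤ d) {β h : ℝ} (hβ : 0 < β) (hh : 0 < h) :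
    ContinuousAt (fun p : ℝ × ℝ => p.1 * magnetizationInField d p.1 p.2) (β, h) :=
  ((continuous_fst.tendsto (β, h)).mul (continuousAt_magnetizationInField_uncurry hd hβ hh).tendsto)

/-- **Both partial derivatives of `ψ` at `(β,h)`, `β > 0`, `h > 0`, are attained and jointly continuous**: the pair
`(∂ψ/∂β, ∂ψ/∂h) = (Σᵢ ⟨σ_0σ_{eᵢ}⟩⁺ + h m, β m)` at `(β,h)` together with their joint continuity (the data of `ψ ∈ C¹` on the
open quadrant). [cite: FriedliVelenik2017, Thm. 3.6, Thm. 3.43 and Thm. 3.25 (1)] -/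
theorem hasDerivAt_pressure_partials_of_pos (hd : 1 ≤ d) {β h : ℝ} (hβ : 0 < β) (hh : 0 < h) :
    HasDerivAt (fun b => pressure d b h) (∑ i, plusCorr d β h {0, Pi.single i 1} + h * magnetizationInField d β h) β ∧
      HasDerivAt (fun t => pressure d β t) (β * magnetizationInField d β h) h ∧
        ContinuousAt (fun p : ℝ × ℝ =>
          (∑ i, plusCorr d p.1 p.2 {0, Pi.single i 1} + p.2 * magnetizationInField d p.1 p.2,
            p.1 * magnetizationInField d p.1 p.2)) (β, h) :=
  ⟨hasDerivAt_pressure_beta_of_pos_field hd hβ hh, hasDerivAt_pressure_field hd hβ.le hh,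
    (continuousAt_energyField_uncurry hd hβ hh).prodMk (continuousAt_deriv_pressure_field_uncurry hd hβ hh)⟩

end IsingSusceptibility

end Summit.CriticalPhenomena.PercolationContinuityZ3.Theorems.FK

end
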